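/-
Copyright: the b2b-balaban T⁴-continuum CRUX team, row NE7b OWNER lineage `t4-ne7b-p1` (gen 117). Project licence.
-/
import Summits.QuantumFields.BalabanUV.T4Continuum.Spine.NE7b.SupTorusDirichletFormCoercive
import Summits.QuantumFields.BalabanUV.T4Continuum.Spine.NE7b.SupTorusEffectiveActionHessian

/-!
# THE HESSIAN OF THE TORUS EFFECTIVE ACTION HAS A MESH- AND VOLUME-FREE FLOOR:
# `(min(2,a) − λ)·(n+1)^d·Σ_y k y² ≤ (S∘σt)″(wt) k k` — the next-scale action is STRICTLY CONVEX at the small-field background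
# whenever the sitewise curvature `u′ ≥ −λ` stays below the torus Dirichlet floor `min(2,a)` of `Δ^η + aQ′*Q′`; letters form at
# TEA's level (form floor `γ` + `u′ ≥ −λ` + block Jensen ⟹ `(γ − λ)·vol·Σ k² ≤ vol·Σ (Mt k)·k`), the torus instance of the three
# letters ((89) `torus_operator_form_coercive` + `blockVolume_mul_sum_sq_blockAvg_le`), and HESS §2's Hessian WITH ITS FLOOR
# (row NE7b, node U5c; (89) + TEA + HESS BY NAME; [folklore])

Cell `pub-balaban`, sub-cell `t4`, spine estimate NE7b (`T4WeightBudget.RelWeightBound`; the cell's OWN estimate — NOT PRINTED in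
[Bałaban 1983–89], NOT PROVED).  Crux-route work under `Spine/NE7b/` by the row OWNER (`t4-ne7b-p1` gen 117) under FREEZE (0)'s
crux-prover clause, on leaf-03 g156's located item («no positivity ∕ floor of the Hessian is claimed here (HSAH
`floor_hessian_comp_branch` would need a floor for `S″(σt wt)` on the fibre directions — the torus Dirichlet form's coercivity, NOT
typed)», HESS docstring); NOTHING of Bałaban's is named as a Lean object, valued or asserted; no `T4Continuum/Support` leaf typed; no
`def`, no notation; zero `sorry`.  Imports (BY NAME): the OWNER's (89) `…SupTorusDirichletFormCoercive`
(`torus_operator_form_coercive`, `blockVolume_mul_sum_sq_blockAvg_le`) and leaf-03's HESS `…SupTorusEffectiveActionHessian` (`linearised_pairing`,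
`hessian_effectiveAction_torus_of_letters`; through it TEA `hessian_effectiveAction_apply_of_linearised`).

WHY (located).  HESS identified `(S∘σt)″(wt) k k′ = (n+1)^d·Σ_y (Mt k) y·k′ y` with `Mt = Rc∘Q′∘(A + N′(σ))∘Dσ∘Ec` the next-scale
operator conjugated to the torus, through TEA's linearised fibre letter `hlin`.  Read `hlin` BACKWARDS on the response `h = Dt k`
itself (a section: `Qt (Dt k) = k`): `(n+1)^d·Σ_y (Mt k) y·k y = Σ_x ((At h) x + u′(φ x)·h x)·h x = ⟨h, At h⟩ + Σ_x u′(φ x) h x²`.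
The first term is the torus Dirichlet form of `Δ^η + aQ′*Q′`, `≥ min(2,a)·Σ h²` by (89); the second is `≥ −λ·Σ h²`; and
`Σ_x h x² ≥ (n+1)^d·Σ_y ((Qt h) y)² = (n+1)^d·Σ_y k y²` by the block Jensen letter.  No norm, no chart constant, no HSAH `q`: the
floor is in the `ℓ²` pairing the Hessian formula is written in, with the constant `min(2,a) − λ` of the `ℤ^d` column — the same at
every mesh `n`, every period `s`, every dimension `d`.

WHAT IS PROVED ([folklore]):
* §1 (TEA's level: finite carriers `ι κ`, ANY `At, Qt, Dt, Mt, u′, φ, vol`) **`response_form_floor`** (`γ·Σ h² ≤ ⟨h, At h⟩`, `−λ ≤ u′(φ x)`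
  ⟹ `(γ − λ)·Σ_x (h x)² ≤ Σ_x ((At h) x + u′(φ x)·h x)·h x`), **`hessianForm_floor_response`** (for ANY bilinear `H` with TEA §2's action:
  `(γ − λ)·Σ_x (Dt k x)² ≤ H.bilinearComp Dt Dt k k` — no sign condition), **`hessianForm_floor`** (+ block Jensen
  `vol·Σ (Qt h)² ≤ Σ h²`, `Qt∘Dt = 1`, `λ ≤ γ` ⟹ `(γ − λ)·vol·Σ_y k y² ≤ H.bilinearComp Dt Dt k k`), **`nextScale_form_floor_response`** ∕
  **`nextScale_form_floor`** (the same two floors for `vol·Σ_y (Mt k) y·k y` under TEA's `hlin`).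
* §2 (the `Beta.Site` carriers, displayed actions) `curvature_floor`, **`torus_nextScale_form_floor_response`** ∕
  **`torus_nextScale_form_floor`**:
  `At = Rf∘Aop∘Ef`, `Qt = Rc∘Dop∘Ef`, `vol = (n+1)^d`, `|u′| ≤ λ` ⟹ under `hlin`:
  `(min(2,a) − λ)·Σ_x (Dt k x)² ≤ (n+1)^d·Σ_y (Mt k) y·k y` and, for `λ ≤ min(2,a)`,
  `(min(2,a) − λ)·(n+1)^d·Σ_y k y² ≤ (n+1)^d·Σ_y (Mt k) y·k y`.
* §3 THE END, HESS §2's letters VERBATIM + `|u′| ≤ λ`: **`hessian_effectiveAction_torus_floor_of_letters`** —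
  `∃ H2, HasFDerivAt (fderiv (S∘σt)) H2 wt ∧ (H2 k k′ = (n+1)^d·Σ_y (Mt k) y·k′ y) ∧
  (∀ k, (min(2,a) − λ)·Σ_x (Dt k x)² ≤ H2 k k) ∧ (λ ≤ min(2,a) → ∀ k, (min(2,a) − λ)·(n+1)^d·Σ_y k y² ≤ H2 k k)`,
  `Dt = Rf∘Df wt∘Ec` the torus response.
* §4 toy.

HONEST (what this is NOT).  Finite sums + (89)'s floor + TEA ∕ HESS by name; the constant `min(2,a) − λ` is OURS and not sharp; positive
only in the window `λ < min(2,a)` (a CONDITION on the sitewise curvature, not discharged here for any particular potential — for the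
`φ⁴_d` instance of (86)∕(87) it reads `6|g|r² + 2|m| < min(2,a)` on the background ball, located, not typed); no minimality ∕ existence
of critical points (CRIT has the zeroth-order row), no convexity AWAY from the background, no statement about the measure; cubic
periods; scalar skeleton, not the covariant operators ((A3), NC-NE7b-α UNRULED); nothing of Bałaban's.  BY-NAME EFFECT ON THE WALL:
NONE.  NE7b NOT PRINTED ∕ NOT PROVED; spine PROVED 0∕9; rung (B)+1 on a FINITE torus — NOT infinite volume, NOT the mass gap, NOT
Clay.  HONEST DEPENDENCY: continuum YM on T⁴ ⇐ BetaPertH ∧ nine spine estimates (0∕9 proved); BetaPertH ⇐ (D1) ∧ (D4) ∧ CAP+tail;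
G-an2-4 gates asym, D1 and NE2∕3∕4.
-/

set_option autoImplicit false

noncomputable section

namespace Summit.QuantumFields.BalabanUV.T4Continuum.NE7b.SupTorusEffectiveActionHessianFloor

open Set Metric Function
open scoped ENNReal NNReal Topology
open Literature.MathematicalPhysics.QuantumFieldTheory.Balaban1983to89
open B6QGQLower276 (X blk B side AX)
open B5Hk103ScalarZd (nbhd)
open Beta (Site siteOf windowMap)
open SupTorusDirichletFormCoercive (torus_operator_form_coercive blockVolume_mul_sum_sq_blockAvg_le)
open SupTorusEffectiveActionHessian (linearised_pairing hessian_effectiveAction_torus_of_letters)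

variable {d : ℕ}

/-! ## §1. TEA's level: a form floor, a curvature floor and block Jensen give the Hessian floor -/

section Generic

variable {ι κ : Type*} [Fintype ι] [Fintype κ]

/-- **THE LINEARISED FIELD OPERATOR'S FORM HAS THE FLOOR `γ − λ` ON EVERY FIELD**: `γ·Σ h² ≤ ⟨h, At h⟩` and `−λ ≤ u′(φ x)` give
`(γ − λ)·Σ_x (h x)² ≤ Σ_x ((At h) x + u′(φ x)·h x)·h x`. [folklore] -/
theorem response_form_floor (At : (ι → ℝ) →L[ℝ] (ι → ℝ)) {u' : ℝ → ℝ} {φ : ι → ℝ} {γ lam : ℝ}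
    (hγ : ∀ h : ι → ℝ, γ * ∑ x, h x ^ 2 ≤ ∑ x, h x * At h x) (hu' : ∀ x, -lam ≤ u' (φ x)) (h : ι → ℝ) :
    (γ - lam) * ∑ x, h x ^ 2 ≤ ∑ x, (At h x + u' (φ x) * h x) * h x := by
  have h1 : ∑ x, (At h x + u' (φ x) * h x) * h x = ∑ x, h x * At h x + ∑ x, u' (φ x) * h x ^ 2 := by
    rw [← Finset.sum_add_distrib]
    exact Finset.sum_congr rfl fun x _ => by ring
  have h2 : -lam * ∑ x, h x ^ 2 ≤ ∑ x, u' (φ x) * h x ^ 2 := by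
    rw [Finset.mul_sum]
    exact Finset.sum_le_sum fun x _ => mul_le_mul_of_nonneg_right (hu' x) (sq_nonneg _)
  rw [h1, sub_mul]
  linarith [hγ h]

/-- **THE TRANSPORTED HESSIAN FORM IS FLOORED ON THE RESPONSE** (no sign condition): for ANY bilinear `H` with TEA §2's action
`H k k′ = Σ_x ((At k) x + u′(φ x)·k x)·k′ x`, `(γ − λ)·Σ_x (Dt k x)² ≤ H.bilinearComp Dt Dt k k`. [folklore] -/
theorem hessianForm_floor_response (At : (ι → ℝ) →L[ℝ] (ι → ℝ)) {u' : ℝ → ℝ} {φ : ι → ℝ} {γ lam : ℝ}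
    (hγ : ∀ h : ι → ℝ, γ * ∑ x, h x ^ 2 ≤ ∑ x, h x * At h x) (hu' : ∀ x, -lam ≤ u' (φ x))
    (Dt : (κ → ℝ) →L[ℝ] (ι → ℝ)) {H : (ι → ℝ) →L[ℝ] (ι → ℝ) →L[ℝ] ℝ}
    (hH : ∀ k k' : ι → ℝ, H k k' = ∑ x, (At k x + u' (φ x) * k x) * k' x) (k : κ → ℝ) :
    (γ - lam) * ∑ x, Dt k x ^ 2 ≤ H.bilinearComp Dt Dt k k := by
  rw [ContinuousLinearMap.bilinearComp_apply, hH]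
  exact response_form_floor At hγ hu' (Dt k)

/-- **THE TRANSPORTED HESSIAN FORM IS FLOORED ON THE COARSE FIELD**: with the block Jensen letter `vol·Σ_y ((Qt h) y)² ≤ Σ_x (h x)²`,
the section property `Qt (Dt k) = k` and `λ ≤ γ`: `(γ − λ)·(vol·Σ_y k y²) ≤ H.bilinearComp Dt Dt k k`. [folklore] -/
theorem hessianForm_floor (At : (ι → ℝ) →L[ℝ] (ι → ℝ)) {u' : ℝ → ℝ} {φ : ι → ℝ} {γ lam : ℝ}
    (hγ : ∀ h : ι → ℝ, γ * ∑ x, h x ^ 2 ≤ ∑ x, h x * At h x) (hu' : ∀ x, -lam ≤ u' (φ x)) (hγlam : lam ≤ γ)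
    (Dt : (κ → ℝ) →L[ℝ] (ι → ℝ)) (Qt : (ι → ℝ) →L[ℝ] (κ → ℝ)) (hsec : ∀ k : κ → ℝ, Qt (Dt k) = k) {vol : ℝ}
    (hJ : ∀ h : ι → ℝ, vol * ∑ y, Qt h y ^ 2 ≤ ∑ x, h x ^ 2)
    {H : (ι → ℝ) →L[ℝ] (ι → ℝ) →L[ℝ] ℝ} (hH : ∀ k k' : ι → ℝ, H k k' = ∑ x, (At k x + u' (φ x) * k x) * k' x)
    (k : κ → ℝ) :
    (γ - lam) * (vol * ∑ y, k y ^ 2) ≤ H.bilinearComp Dt Dt k k := by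
  have hJk : vol * ∑ y, k y ^ 2 ≤ ∑ x, Dt k x ^ 2 := by
    have h := hJ (Dt k)
    rwa [hsec k] at h
  exact (mul_le_mul_of_nonneg_left hJk (sub_nonneg.2 hγlam)).trans (hessianForm_floor_response At hγ hu' Dt hH k)

/-- **THE NEXT-SCALE OPERATOR'S FORM IS FLOORED ON THE RESPONSE** (TEA's `hlin` read backwards on the response itself): if
`Σ_x ((At(Dt k)) x + u′(φ x)·(Dt k) x)·h x = vol·Σ_y (Mt k) y·(Qt h) y` for all `k h` and `Qt (Dt k) = k`, then
`(γ − λ)·Σ_x (Dt k x)² ≤ vol·Σ_y (Mt k) y·k y`. [folklore] -/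
theorem nextScale_form_floor_response (At : (ι → ℝ) →L[ℝ] (ι → ℝ)) {u' : ℝ → ℝ} {φ : ι → ℝ} {γ lam : ℝ}
    (hγ : ∀ h : ι → ℝ, γ * ∑ x, h x ^ 2 ≤ ∑ x, h x * At h x) (hu' : ∀ x, -lam ≤ u' (φ x))
    (Dt : (κ → ℝ) →L[ℝ] (ι → ℝ)) (Qt : (ι → ℝ) →L[ℝ] (κ → ℝ)) (hsec : ∀ k : κ → ℝ, Qt (Dt k) = k)
    {Mt : (κ → ℝ) →L[ℝ] (κ → ℝ)} {vol : ℝ}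
    (hlin : ∀ (k : κ → ℝ) (h : ι → ℝ), ∑ x, (At (Dt k) x + u' (φ x) * Dt k x) * h x = vol * ∑ y, Mt k y * Qt h y)
    (k : κ → ℝ) :
    (γ - lam) * ∑ x, Dt k x ^ 2 ≤ vol * ∑ y, Mt k y * k y := by
  have h := hlin k (Dt k)
  rw [hsec k] at h
  rw [← h]
  exact response_form_floor At hγ hu' (Dt k)

/-- **THE NEXT-SCALE OPERATOR'S FORM IS FLOORED ON THE COARSE FIELD**: under `hlin`, `Qt∘Dt = 1`, the block Jensen letter and `λ ≤ γ`,
`(γ − λ)·(vol·Σ_y k y²) ≤ vol·Σ_y (Mt k) y·k y`. [folklore] -/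
theorem nextScale_form_floor (At : (ι → ℝ) →L[ℝ] (ι → ℝ)) {u' : ℝ → ℝ} {φ : ι → ℝ} {γ lam : ℝ}
    (hγ : ∀ h : ι → ℝ, γ * ∑ x, h x ^ 2 ≤ ∑ x, h x * At h x) (hu' : ∀ x, -lam ≤ u' (φ x)) (hγlam : lam ≤ γ)
    (Dt : (κ → ℝ) →L[ℝ] (ι → ℝ)) (Qt : (ι → ℝ) →L[ℝ] (κ → ℝ)) (hsec : ∀ k : κ → ℝ, Qt (Dt k) = k) {vol : ℝ}
    (hJ : ∀ h : ι → ℝ, vol * ∑ y, Qt h y ^ 2 ≤ ∑ x, h x ^ 2) {Mt : (κ → ℝ) →L[ℝ] (κ → ℝ)}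
    (hlin : ∀ (k : κ → ℝ) (h : ι → ℝ), ∑ x, (At (Dt k) x + u' (φ x) * Dt k x) * h x = vol * ∑ y, Mt k y * Qt h y)
    (k : κ → ℝ) :
    (γ - lam) * (vol * ∑ y, k y ^ 2) ≤ vol * ∑ y, Mt k y * k y := by
  have hJk : vol * ∑ y, k y ^ 2 ≤ ∑ x, Dt k x ^ 2 := by
    have h := hJ (Dt k)
    rwa [hsec k] at h
  exact (mul_le_mul_of_nonneg_left hJk (sub_nonneg.2 hγlam)).trans
    (nextScale_form_floor_response At hγ hu' Dt Qt hsec hlin k)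

end Generic

/-! ## §2. The torus instance of the three letters -/

section Torus

variable (n : ℕ) (a : ℝ) (s : ℕ) [NeZero s]
  {Dop Aop Pop : lp (fun _ : X d => ℝ) ∞ →L[ℝ] lp (fun _ : X d => ℝ) ∞}
  (hD : ∀ (f : lp (fun _ : X d => ℝ) ∞) (y : X d), Dop f y = (((n : ℝ) + 1) ^ d)⁻¹ * ∑ p ∈ B n y, f p)
  (hA : ∀ (f : lp (fun _ : X d => ℝ) ∞) (p : X d), Aop f p = ∑ r ∈ nbhd n p, AX n a p r * f r)
  (hP : ∀ (f : lp (fun _ : X d => ℝ) ∞) (p : X d), Pop f p = f p - (((n : ℝ) + 1) ^ d)⁻¹ * ∑ p' ∈ B n (blk n p), f p')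
  {N' : lp (fun _ : X d => ℝ) ∞ → (lp (fun _ : X d => ℝ) ∞ →L[ℝ] lp (fun _ : X d => ℝ) ∞)} {u' : ℝ → ℝ}
  (hN' : ∀ (φ h : lp (fun _ : X d => ℝ) ∞) (p : X d), N' φ h p = u' (φ p) * h p)
  {lam : ℝ} (hlam : ∀ t, |u' t| ≤ lam)
  {Ef : (Site d ((n + 1) * s) → ℝ) →L[ℝ] lp (fun _ : X d => ℝ) ∞}
  (hEf : ∀ (g : Site d ((n + 1) * s) → ℝ) (q : X d), Ef g q = g (siteOf d ((n + 1) * s) q))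
  {Rf : lp (fun _ : X d => ℝ) ∞ →L[ℝ] (Site d ((n + 1) * s) → ℝ)}
  (hRf : ∀ (h : lp (fun _ : X d => ℝ) ∞) (x : Site d ((n + 1) * s)), Rf h x = h (windowMap d ((n + 1) * s) x))
  {Ec : (Site d s → ℝ) →L[ℝ] lp (fun _ : X d => ℝ) ∞}
  {Rc : lp (fun _ : X d => ℝ) ∞ →L[ℝ] (Site d s → ℝ)}
  (hRc : ∀ (h : lp (fun _ : X d => ℝ) ∞) (x : Site d s), Rc h x = h (windowMap d s x))

include hlam in
omit [NeZero s] in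
/-- `|u′| ≤ λ` gives the curvature floor `−λ ≤ u′(φ x)`. [folklore] -/
theorem curvature_floor {ι : Type*} (φ : ι → ℝ) (x : ι) : -lam ≤ u' (φ x) :=
  (abs_le.1 (hlam (φ x))).1

include hA hEf hRf hlam in
/-- **THE TORUS NEXT-SCALE FORM IS FLOORED ON THE RESPONSE**: for ANY response `Dt` into the fine torus carrier with torus block means
`= 1` and ANY `Mt` satisfying TEA's linearised fibre letter with `At = Rf∘Aop∘Ef`, `Qt = Rc∘Dop∘Ef`, `vol = (n+1)^d`:
`(min(2,a) − λ)·Σ_x (Dt k x)² ≤ (n+1)^d·Σ_y (Mt k) y·k y` — no sign condition. [folklore] -/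
theorem torus_nextScale_form_floor_response {φ : Site d ((n + 1) * s) → ℝ}
    {Dt : (Site d s → ℝ) →L[ℝ] (Site d ((n + 1) * s) → ℝ)} (hsec : ∀ k : Site d s → ℝ, ((Rc.comp Dop).comp Ef) (Dt k) = k)
    {Mt : (Site d s → ℝ) →L[ℝ] (Site d s → ℝ)}
    (hlin : ∀ (k : Site d s → ℝ) (h : Site d ((n + 1) * s) → ℝ),
      ∑ x, (((Rf.comp Aop).comp Ef) (Dt k) x + u' (φ x) * Dt k x) * h x
        = ((n : ℝ) + 1) ^ d * ∑ y, Mt k y * ((Rc.comp Dop).comp Ef) h y)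
    (k : Site d s → ℝ) :
    (min 2 a - lam) * ∑ x, Dt k x ^ 2 ≤ ((n : ℝ) + 1) ^ d * ∑ y, Mt k y * k y :=
  nextScale_form_floor_response ((Rf.comp Aop).comp Ef) (torus_operator_form_coercive n a s hA hEf hRf)
    (curvature_floor hlam φ) Dt ((Rc.comp Dop).comp Ef) hsec hlin k

include hD hA hEf hRf hRc hlam in
/-- **THE TORUS NEXT-SCALE FORM IS FLOORED ON THE COARSE FIELD, MESH- AND VOLUME-FREE**: under the same letters and `λ ≤ min(2,a)`,
`(min(2,a) − λ)·((n+1)^d·Σ_y k y²) ≤ (n+1)^d·Σ_y (Mt k) y·k y` — every `n`, `s`, `d`. [folklore] -/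
theorem torus_nextScale_form_floor (hγ : lam ≤ min 2 a) {φ : Site d ((n + 1) * s) → ℝ}
    {Dt : (Site d s → ℝ) →L[ℝ] (Site d ((n + 1) * s) → ℝ)} (hsec : ∀ k : Site d s → ℝ, ((Rc.comp Dop).comp Ef) (Dt k) = k)
    {Mt : (Site d s → ℝ) →L[ℝ] (Site d s → ℝ)}
    (hlin : ∀ (k : Site d s → ℝ) (h : Site d ((n + 1) * s) → ℝ),
      ∑ x, (((Rf.comp Aop).comp Ef) (Dt k) x + u' (φ x) * Dt k x) * h x
        = ((n : ℝ) + 1) ^ d * ∑ y, Mt k y * ((Rc.comp Dop).comp Ef) h y)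
    (k : Site d s → ℝ) :
    (min 2 a - lam) * (((n : ℝ) + 1) ^ d * ∑ y, k y ^ 2) ≤ ((n : ℝ) + 1) ^ d * ∑ y, Mt k y * k y :=
  nextScale_form_floor ((Rf.comp Aop).comp Ef) (torus_operator_form_coercive n a s hA hEf hRf) (curvature_floor hlam φ)
    hγ Dt ((Rc.comp Dop).comp Ef) hsec
    (fun h => by simpa only [ContinuousLinearMap.comp_apply] using blockVolume_mul_sum_sq_blockAvg_le n s hD hEf hRc h) hlin k

/-! ## §3. THE END: HESS §2's Hessian with its floor -/

include hD hA hP hN' hEf hRf hRc hlam in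
/-- **THE HESSIAN OF THE TORUS EFFECTIVE ACTION WITH ITS FLOOR, LETTERS FORM** (HESS `hessian_effectiveAction_torus_of_letters`'s
hypotheses VERBATIM + `|u′| ≤ λ`): for ANY background `σ` with torus background `σt = Rf∘σ∘Ec`, a response family `Df` on the open
torus ball `ball 0 ρ ∋ wt` (`HasFDerivAt σ (Df w′) (Ec w′)`, torus block means of the torus response `= 1`, the sitewise equation at
every `σt w′`), and at `wt` the identifications `Ef(σt wt) = σ(Ec wt)`, `Ef(Dt k) = Df wt (Ec k)` and (63)'s linearised fibre equation:
`∃ H2, HasFDerivAt (fderiv (S∘σt)) H2 wt`, `H2 k k′ = (n+1)^d·Σ_y (Mt k) y·k′ y` (`Mt = (Rc∘Q′)∘(A + N′(σ(Ec wt)))∘(Df wt∘Ec)`), AND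
THE FLOORS `(min(2,a) − λ)·Σ_x (Dt k x)² ≤ H2 k k` (`Dt = Rf∘Df wt∘Ec`, no sign condition) and, when `λ ≤ min(2,a)`,
`(min(2,a) − λ)·(n+1)^d·Σ_y k y² ≤ H2 k k` — THE NEXT-SCALE ACTION IS STRICTLY CONVEX AT THE BACKGROUND, modulus mesh- and
volume-free. [folklore] -/
theorem hessian_effectiveAction_torus_floor_of_letters {v u : ℝ → ℝ} (hv : ∀ t, HasDerivAt v (u t) t)
    (hu : ∀ t, HasDerivAt u (u' t) t)
    {σ : lp (fun _ : X d => ℝ) ∞ → lp (fun _ : X d => ℝ) ∞} {σt : (Site d s → ℝ) → (Site d ((n + 1) * s) → ℝ)}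
    (hσt : ∀ wt, σt wt = Rf (σ (Ec wt))) {ρ : ℝ} {wt : Site d s → ℝ} (hwt : wt ∈ ball (0 : Site d s → ℝ) ρ)
    {Df : (Site d s → ℝ) → (lp (fun _ : X d => ℝ) ∞ →L[ℝ] lp (fun _ : X d => ℝ) ∞)}
    (hDer : ∀ w' ∈ ball (0 : Site d s → ℝ) ρ, HasFDerivAt σ (Df w') (Ec w'))
    (hsec : ∀ w' ∈ ball (0 : Site d s → ℝ) ρ, ∀ k : Site d s → ℝ, Rc (Dop (Ef (((Rf.comp (Df w')).comp Ec) k))) = k)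
    (heq : ∀ w' ∈ ball (0 : Site d s → ℝ) ρ, ∀ p : X d, Aop (Ef (σt w')) p + u (Ef (σt w') p)
      = (((n : ℝ) + 1) ^ d)⁻¹ * ∑ p' ∈ B n (blk n p), (Aop (Ef (σt w')) p' + u (Ef (σt w') p')))
    (hEfσ : Ef (σt wt) = σ (Ec wt)) (hEfD : ∀ vt, Ef (((Rf.comp (Df wt)).comp Ec) vt) = Df wt (Ec vt))
    (hfib : ∀ k : Site d s → ℝ, Pop (Aop (Df wt (Ec k)) + N' (σ (Ec wt)) (Df wt (Ec k))) = 0) :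
    ∃ H2 : (Site d s → ℝ) →L[ℝ] (Site d s → ℝ) →L[ℝ] ℝ,
      HasFDerivAt (fderiv ℝ ((fun φ : Site d ((n + 1) * s) → ℝ =>
          (1 / 2 : ℝ) * ∑ x, φ x * ((Rf.comp Aop).comp Ef) φ x + ∑ x, v (φ x)) ∘ σt)) H2 wt ∧
      (∀ k k' : Site d s → ℝ, H2 k k'
        = ((n : ℝ) + 1) ^ d
            * ∑ y : Site d s, ((Rc.comp Dop).comp ((Aop + N' (σ (Ec wt))).comp ((Df wt).comp Ec))) k y * k' y) ∧
      (∀ k : Site d s → ℝ, (min 2 a - lam) * ∑ x, ((Rf.comp (Df wt)).comp Ec) k x ^ 2 ≤ H2 k k) ∧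
      (lam ≤ min 2 a → ∀ k : Site d s → ℝ, (min 2 a - lam) * (((n : ℝ) + 1) ^ d * ∑ y, k y ^ 2) ≤ H2 k k) := by
  obtain ⟨H2, hH2, hH2app⟩ := hessian_effectiveAction_torus_of_letters n a s hD hA hP hN' hEf hRf hRc hv hu hσt hwt hDer hsec
    heq hEfσ hEfD hfib
  have hlin := linearised_pairing n a s hD hA hP hN' hEf hRf hRc hσt hEfσ hEfD hfib
  have hsecwt : ∀ k : Site d s → ℝ, ((Rc.comp Dop).comp Ef) (((Rf.comp (Df wt)).comp Ec) k) = k := fun k => by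
    simp only [ContinuousLinearMap.comp_apply]
    exact hsec wt hwt k
  refine ⟨H2, hH2, hH2app, fun k => ?_, fun hγ k => ?_⟩
  · rw [hH2app k k]
    exact torus_nextScale_form_floor_response n a s hA hlam hEf hRf hsecwt hlin k
  · rw [hH2app k k]
    exact torus_nextScale_form_floor n a s hD hA hlam hEf hRf hRc hγ hsecwt hlin k

end Torus

/-! ## §4. Toy -/

/-- Toy (§1 on one site): `At = 0`, floor `γ = 0` holds trivially, `u′ ≡ 1 ≥ −0`; the response form `Σ (0 + 1·h)·h = Σ h²` is
floored by `(0 − 0)·Σ h²`. -/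
example (h : Unit → ℝ) :
    ((0 : ℝ) - 0) * ∑ x, h x ^ 2 ≤ ∑ x, ((0 : (Unit → ℝ) →L[ℝ] (Unit → ℝ)) h x + (fun _ : ℝ => (1 : ℝ)) (h x) * h x) * h x :=
  response_form_floor (ι := Unit) 0 (u' := fun _ : ℝ => (1 : ℝ)) (φ := h) (γ := 0) (lam := 0) (fun h => by simp)
    (fun _ => by norm_num) h

end Summit.QuantumFields.BalabanUV.T4Continuum.NE7b.SupTorusEffectiveActionHessianFloor

end
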